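import Summits.AnomalousDissipation.AnomalousDissipation.Theorems.SawtoothPulseCascadeK1LocalisedCascadeLedgerThinClose
import Summits.AnomalousDissipation.AnomalousDissipation.Theorems.SawtoothPulseCascadeK1LocalisedCascadeLedgerThinChain
import Literature.Analysis.FluidPDE.SawtoothCascadeSmooth

/-!
# Sketch — crux idea card `averaged-comb-ledger` (planner ad-ideate-p5, lens `profile` = profile-and-certify) on
`K1LocalisedCascade` (stmt-AnomalousDissipation-19491; live re-target shape P; live S-D target = the uniform thin iterate
bound `hiter` of `K1Ledger.From.k1Localised_of_thin_iterate_bound`).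

Statements only (`Prop`s / signatures over existing declarations); the `example`s are plumbing.  Rev 3 (gen 2, 2026-08-28): §4 adds the
envelope-free averaged weight `barWeight` and re-targets the assembly at the LANDED closer `K1Ledger.From.k1Localised_of_energy_ledger`
(`WeightDominatesPair`, `AveragedWeightStep` = K2′, `AveragedWeightStart` = K3′, `LineAssemblyEnergy`); §§0–3 are rev 2 verbatim.
-/

set_option linter.dupNamespace false
set_option linter.unusedVariables false

noncomputable section

namespace Summit.AnomalousDissipation.AnomalousDissipation.Cruxes.K1LocalisedCascade.AveragedCombLedger

open MeasureTheory Set Filter Topology UnitAddTorus Function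
open scoped ENNReal
open Literature.Analysis Literature.Analysis.FunctionSpaces Literature.Analysis.FunctionSpaces.Torus Literature.Analysis.FluidPDE
open Literature.Analysis.FluidPDE.ShearStage
open Literature.Analysis.FluidPDE.SawtoothCascade Literature.Analysis.FluidPDE.SawtoothCascade.CascadeParams

/-! ## 0. The objects of the S-D target (verbatim from the thin closer) -/

/-- The THIN tracked symbol `μ_n(k; γ, c, L_min) = 1 − g^S·g^env` of `K1Ledger.From.k1Localised_of_thin_iterate_bound`
(verbatim integrand of `hiter`; `ε = 1/250`, `ε_a = 1/20`, aperture `13/10`, `L = c r^n`, `r = γ² − 3`). -/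
def thinSymbol (γ c Lm : ℝ) (n : ℕ) (k : Fin 2 → ℤ) : ℝ :=
  1 - Real.smoothTransition ((|((k 0 : ℤ) : ℝ)| - c * (γ ^ 2 - 3) ^ n) / (1 / 250 * (c * (γ ^ 2 - 3) ^ n))) *
      (1 - Real.smoothTransition ((γ * |((k 1 : ℤ) : ℝ)| - 13 / 10 * |((k 0 : ℤ) : ℝ)|) / (1 / 20 * (c * (γ ^ 2 - 3) ^ n)))) *
    ((1 - Real.smoothTransition ((|((k 0 : ℤ) : ℝ)| - 2 * (c * (γ ^ 2 - 3) ^ n / ((γ ^ 2 - 5 / 2) / (1 + 1 / 250) ^ 2 - 1 / (2 * (1 + 1 / 250) * Lm)) ^ n) * ((1 + γ) ^ 2 + 1) ^ n) /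
        (c * (γ ^ 2 - 3) ^ n / (20 * γ * (1 + 1 / 250))))) *
      (1 - Real.smoothTransition ((|((k 1 : ℤ) : ℝ)| - 2 * (c * (γ ^ 2 - 3) ^ n / ((γ ^ 2 - 5 / 2) / (1 + 1 / 250) ^ 2 - 1 / (2 * (1 + 1 / 250) * Lm)) ^ n) * ((1 + γ) ^ 2 + 1) ^ n) /
        (c * (γ ^ 2 - 3) ^ n / (20 * γ * (1 + 1 / 250))))))

/-- The explicit inviscid iterates `a 0 = datum`, `a (j+1) = (a j ∘ H_j) ∘ V_j` (the `a`/`b` of the closer's `hb`/`hab`). -/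
def iterate (P : CascadeParams) (hδ₀ : 0 < P.δ₀) (hd : 0 < P.d) : ℕ → UnitAddTorus (Fin 2) → ℝ
  | 0 => datum
  | j + 1 => (iterate P hδ₀ hd j ∘ shearMap 0 1 (amp ⟨P.U j, P.U_periodic j, P.contDiff_U (P.δ_pos hδ₀ hd j)⟩ P.γ)) ∘
      shearMap 1 0 (amp ⟨P.U j, P.U_periodic j, P.contDiff_U (P.δ_pos hδ₀ hd j)⟩ P.γ)

/-- Tracked ("not yet certified good") energy of the phase-`n` iterate: the square of the `hiter` functional. -/
def trackedEnergy (P : CascadeParams) (hδ₀ : 0 < P.δ₀) (hd : 0 < P.d) (Lm c : ℝ) (n : ℕ) : ℝ :=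
  ∑' k : Fin 2 → ℤ, thinSymbol P.γ c Lm n k ^ 2 * ‖mFourierCoeff (fun x => (iterate P hδ₀ hd n x : ℂ)) k‖ ^ 2

/-- **The S-D target** (= hypothesis `hiter` of `k1Localised_of_thin_iterate_bound`, from phase `i₁` on). -/
def UniformThinBound (P : CascadeParams) (hδ₀ : 0 < P.δ₀) (hd : 0 < P.d) (Lm c q : ℝ) (i₁ : ℕ) : Prop :=
  ∀ n : ℕ, i₁ ≤ n → Real.sqrt (trackedEnergy P hδ₀ hd Lm c n) ≤ q

/-! ## 1. First lemma — the exact sawtooth fibre kernel is a closed-form two-lobe sinc comb -/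

/-- `sinc₀ x = sin x / x`, `sinc₀ 0 = 1`. -/
def sinc0 (x : ℝ) : ℝ := if x = 0 then 1 else Real.sin x / x

/-- The `δ = 0` phase function of a half-step on the fibre with frequency parameter `a` (`a = γ k₀` for `H_j`, `a = γ k₁` for
`V_j`) and `N` teeth: `y ↦ exp(−2πi·a·tri(2πNy)/(2πN))`, `tri = arcsin ∘ sin` (`SawtoothCascade.tri`); 1-periodic in `y`. -/
def combPhase (a : ℝ) (N : ℕ) (y : ℝ) : ℂ :=
  Complex.exp (-(2 * Real.pi * Complex.I * (a * (tri (2 * Real.pi * N * y) / (2 * Real.pi * N)))))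

/-- **FIRST LEMMA (`CombKernelFormula`).** The Fourier coefficients of the exact-sawtooth phase function vanish off `Nℤ` and on
`m = lN` equal `½·sinc₀(π(a+m)/(2N)) + ½·(−1)^l·sinc₀(π(a−m)/(2N))` (rise lobe at `m ≈ −a`, fall lobe at `m ≈ +a`, odd
sidebands `|·|² = 1/(π² l′²)`; `Σ_m |·|² = 1`).  Two elementary integrals of `exp(linear)` over `[−1/(4N), 1/(4N)]` and
`[1/(4N), 3/(4N)]`. This is the kernel the certified computation (K3) evaluates and the analytic step (K2) splits into pieces. -/
def CombKernelFormula : Prop :=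
  ∀ (a : ℝ) (N : ℕ), 0 < N → ∀ m : ℤ,
    (∫ y in (0:ℝ)..1, combPhase a N y * Complex.exp (-(2 * Real.pi * Complex.I * m * y))) =
      if (N : ℤ) ∣ m then
        (((sinc0 (Real.pi * (a + m) / (2 * N)) + (-1 : ℝ) ^ (m / N).natAbs * sinc0 (Real.pi * (a - m) / (2 * N))) / 2 : ℝ) : ℂ)
      else 0

/-! ## 2. The threshold-averaged ("bar") symbol and its domination of the verbatim thin symbol -/

/-- `ramp x = min 1 (max 0 x)`: the window average of a sharp threshold, `⨍_{t∈[t₁,t₂]} 𝟙[x > t] dt = ramp((x−t₁)/(t₂−t₁))`. -/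
def ramp (x : ℝ) : ℝ := min 1 (max 0 x)

/-- The THRESHOLD-AVERAGED symbol `μ̄_n = 1 − ḡ_low·ḡ_cone·ḡ_env`: each of the three thresholds of `μ_n` (low block `|k₀| ≈ c rⁿ`,
cone aperture `13/10`, `Γ`-envelope) replaced by its average over a window on the DOMINATING side — low threshold
`t ∈ [(1+1/250)c, 2c]`, aperture `a ∈ [51/50, 13/10]`, envelope `E ∈ [4env/5, env]` (windows chosen below the bulk `|k₀| ≈ (γ²±1)ⁿ`:
`2c·rⁿ ≤ rⁿ < (γ²−1)ⁿ` and `4env/5 > (γ²+1)ⁿ` from `n = 2` at `γ = 8`, `c = 1/2`) — so that `μ_n ≤ μ̄_n` pointwise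
(`Domination`) while every factor of `ḡ` now has RELATIVE transition width `O(1)` instead of `1/250`, `1/20·(…)`. -/
def barSymbol (γ c Lm : ℝ) (n : ℕ) (k : Fin 2 → ℤ) : ℝ :=
  let r : ℝ := γ ^ 2 - 3
  let ρ₀ : ℝ := (γ ^ 2 - 5 / 2) / (1 + 1 / 250) ^ 2 - 1 / (2 * (1 + 1 / 250) * Lm)
  let env : ℝ := 2 * (c * r ^ n / ρ₀ ^ n) * ((1 + γ) ^ 2 + 1) ^ n
  1 - ramp ((|((k 0 : ℤ) : ℝ)| - (1 + 1 / 250) * c * r ^ n) / ((1 - 1 / 250) * c * r ^ n)) *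
        ramp ((13 / 10 * |((k 0 : ℤ) : ℝ)| - γ * |((k 1 : ℤ) : ℝ)|) / ((13 / 10 - 51 / 50) * |((k 0 : ℤ) : ℝ)|)) *
      (ramp ((env - |((k 0 : ℤ) : ℝ)|) / (env / 5)) * ramp ((env - |((k 1 : ℤ) : ℝ)|) / (env / 5)))

/-- Threshold-averaged tracked energy `T̄_n`. -/
def barTrackedEnergy (P : CascadeParams) (hδ₀ : 0 < P.δ₀) (hd : 0 < P.d) (Lm c : ℝ) (n : ℕ) : ℝ :=
  ∑' k : Fin 2 → ℤ, barSymbol P.γ c Lm n k * ‖mFourierCoeff (fun x => (iterate P hδ₀ hd n x : ℂ)) k‖ ^ 2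

/-- **P1 (support, elementary).** `μ_n(k)² ≤ μ̄_n(k)` pointwise (each `ramp` factor is positive only where the corresponding
smooth-transition factor of `g^S g^env` equals `1`), hence `trackedEnergy ≤ barTrackedEnergy`. -/
def Domination : Prop :=
  ∀ (γ c Lm : ℝ) (n : ℕ) (k : Fin 2 → ℤ), 5 ≤ γ → 0 < c → 1000 ≤ Lm → thinSymbol γ c Lm n k ^ 2 ≤ barSymbol γ c Lm n k

/-! ## 3. The cruxes of the line at the shape-P instance `(γ, δ₀, d, N₀, ρN) = (8, δ₀, 2, 1, 2)`, `c = 1/2` (profile j297862: `T̄₂(1/2) = 0.096·E`;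
`c = 7/20` is the alternate once the phase-3 envelope clears), `L_min = 1000` -/

/-- **K2 (crux of the line, analytic): the averaged comb step, ENERGY form.**  From phase `3` on, one full step
`a_j ↦ a_{j+1} = a_j ∘ H_j ∘ V_j` raises `T̄` by at most a summable amount `ℓ_j = (C_s·2^j/(c·61^j) + C_z·√(δ₀/2^j))·E`:
(α) CORNER LAYERS `C_s·2^j/(c 61^j)·E` — on each of the `2N_j = 2^{j+1}` linear pieces of the exact sawtooth a half-step is an exact
frequency translation under which the complement weight `1 − μ̄` is backward-invariant POINTWISE (growth `γ²−1−a ≥ 61 = r` for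
aperture `a ≤ 2`; window averages of monotone thresholds are monotone, so no `1+ε` margin), hence the good energy `⟨F, (1−μ̄)(D)F⟩` drops
only through the cross terms between pieces, bounded by `‖a_j‖_∞² · 2·(2N_j)·2∫₀^∞ z|Ǩ(z)|dz` with `∫ z|Ǩ| ≤ C_K/Δ_j`, `Δ_j = 0.035·c·61^j` the
k-width of the averaged aperture ramp (`C_K ≈ 0.3` for a smooth weight ⇒ `C_s ≈ 140`); (β) ROUNDING ZONES `C_z√(δ₀/2^j)·E` — where
`roundedSaw δ_j ≠ tri` (`δ_j = δ₀/2^j`, y-measure `≈ 4.5 δ_j`), `‖(g_δ − g₀)F‖² ≤ 4|Z_j|‖a_j‖_∞²` and the first-order cross term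
`2‖(g_δ−g₀)F‖·√E` give `C_z ≈ 12`.  Both paid with `‖a_j‖_∞ = ‖datum‖_∞ = 1` (transport preserves `L^∞`; the fibre sum is taken BEFORE the sup:
`Σ_{k₀}|f_{k₀}(x₁)||f_{k₀}(x₁')| ≤ ‖a‖_∞²`, kernel majorant uniform over the high fibres).  Targets: `C_s ≤ 400`, `C_z ≤ 24`. -/
def AveragedCombStep : Prop :=
  ∃ Cs Cz : ℝ, 0 ≤ Cs ∧ Cs ≤ 400 ∧ 0 ≤ Cz ∧ Cz ≤ 24 ∧
    ∀ (δ₀ : ℝ) (hδ₀ : 0 < δ₀), δ₀ ≤ 1 / 256 → ∀ j : ℕ, 3 ≤ j →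
      barTrackedEnergy ⟨8, δ₀, 2, 1, 2⟩ hδ₀ (by norm_num) 1000 (1 / 2) (j + 1) ≤
        barTrackedEnergy ⟨8, δ₀, 2, 1, 2⟩ hδ₀ (by norm_num) 1000 (1 / 2) j +
          (Cs * (2 ^ j / (1 / 2 * 61 ^ j)) + Cz * Real.sqrt (δ₀ / 2 ^ j)) * FluidPDE.Torus.scalarL2Sq datum

/-- **K3 (crux of the line, computational = the profile-and-certify step): certified averaged start at phase 3** of the instance
`(γ, δ₀, c) = (8, 2⁻¹⁶, 1/2)`: `T̄_3 ≤ Q·E` with an explicit `Q` (float sparse exact-comb profile, kit `j297862`: `T̄_2/E = 0.096` at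
`c = 1/2`, garbage included; the budget of `LineAssembly` tolerates any `Q < 0.85`, i.e. it only asks that MORE THAN 15 % of the energy be
fully released at phase 3).  A finite certified computation: three fibre-convolution steps (`Torus.mFourierCoeff_comp_shearMap`) with the
closed-form comb kernels of `CombKernelFormula` (+ the zone terms of K2(β) for phases 0–2, `≈ 0.10·E` at `δ₀ = 2⁻¹⁶`) or ball-arithmetic FFT
kernels of `roundedSaw`, sideband truncation paid exactly by unitarity (`Σ_m |G(m)|² = 1`), magnitude pruning paid exactly (garbage counted
as tracked), sparse (`≈ 2·10⁷` nonzeros at phase 2½). -/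
def CertifiedAveragedStart (Q : ℝ) : Prop :=
  ∀ (hδ₀ : (0:ℝ) < 1 / 65536),
    barTrackedEnergy ⟨8, 1 / 65536, 2, 1, 2⟩ hδ₀ (by norm_num) 1000 (1 / 2) 3 ≤ Q * FluidPDE.Torus.scalarL2Sq datum

/-- **Assembly of the line (support; elementary).**  Telescoping K2 over `j ≥ 3` + `Domination` + the geometric sums
`Σ_{j≥3} 2^j/((1/2)·61^j) = 7.29·10⁻⁵ ≤ 3/40000` and `Σ_{j≥3} √(2⁻¹⁶/2^j) = 0.004715 ≤ 5/1000` give `sup_{n≥3} T_n(1/2) ≤ sup_{n≥3} T̄_n ≤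
(Q + 400·3/40000 + 24·5/1000)·E = (Q + 0.15)·E`, i.e. the S-D bound `hiter` at `(γ, δ₀, c, L_min, i₁) = (8, 2⁻¹⁶, 1/2, 1000, 3)` with
`q = √(Q + 0.15)·√E < √E` iff `Q < 0.85`. -/
def LineAssembly : Prop :=
  ∀ Q : ℝ, 0 ≤ Q → Q + 400 * (3 / 40000) + 24 * (5 / 1000) < 1 →
    Domination → AveragedCombStep → CertifiedAveragedStart Q →
    ∀ (hδ₀ : (0:ℝ) < 1 / 65536),
      UniformThinBound ⟨8, 1 / 65536, 2, 1, 2⟩ hδ₀ (by norm_num) 1000 (1 / 2)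
        (Real.sqrt (Q + 400 * (3 / 40000) + 24 * (5 / 1000)) * Real.sqrt (FluidPDE.Torus.scalarL2Sq datum)) 3

/-- **The S-D target OF RECORD since 2026-08-28T02:14Z** — hypothesis `hrel` of `K1Ledger.From.k1Localised_of_thin_released_energy`
(…LedgerThinRelease): at every phase `n ≥ i₁` a finite set of fully RELEASED modes (`|k₀| ≥ (1+1/250)c rⁿ`, `γ|k₁| ≤ 13/10|k₀|`, inside the
`Γ`-envelope) carries energy `≥ e > 0`.  The complement weight `1 − μ̄_n` is `≤ 1` and positive ONLY on released modes (each `ramp` factor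
vanishes outside its window's dominating side), so `Σ_{released} |𝓕a_n|² ≥ E − T̄_n`: the line feeds `hrel` (with `e = (E − sup_n T̄_n)/2`,
the half absorbing the finite truncation) exactly as it feeds `hiter`. -/
def ReleasedEnergyBound (P : CascadeParams) (hδ₀ : 0 < P.δ₀) (hd : 0 < P.d) (Lm c e : ℝ) (i₁ : ℕ) : Prop :=
  ∀ n : ℕ, i₁ ≤ n → ∃ S : Finset (Fin 2 → ℤ),
    (∀ k ∈ S, (1 + 1 / 250) * (c * (P.γ ^ 2 - 3) ^ n) ≤ |((k 0 : ℤ) : ℝ)| ∧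
      P.γ * |((k 1 : ℤ) : ℝ)| ≤ 13 / 10 * |((k 0 : ℤ) : ℝ)| ∧
      |((k 0 : ℤ) : ℝ)| ≤ 2 * (c * (P.γ ^ 2 - 3) ^ n / ((P.γ ^ 2 - 5 / 2) / (1 + 1 / 250) ^ 2 - 1 / (2 * (1 + 1 / 250) * Lm)) ^ n) * ((1 + P.γ) ^ 2 + 1) ^ n ∧
      |((k 1 : ℤ) : ℝ)| ≤ 2 * (c * (P.γ ^ 2 - 3) ^ n / ((P.γ ^ 2 - 5 / 2) / (1 + 1 / 250) ^ 2 - 1 / (2 * (1 + 1 / 250) * Lm)) ^ n) * ((1 + P.γ) ^ 2 + 1) ^ n) ∧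
    e ≤ ∑ k ∈ S, ‖mFourierCoeff (fun x => (iterate P hδ₀ hd n x : ℂ)) k‖ ^ 2

/-- Released-energy form of the assembly (support): same inputs, output = `hrel` at `(8, 2⁻¹⁶, 1/2, 1000, i₁ = 3)` with
`e = (1 − Q − 0.15)/2 · E > 0`. -/
def LineAssemblyRel : Prop :=
  ∀ Q : ℝ, 0 ≤ Q → Q + 400 * (3 / 40000) + 24 * (5 / 1000) < 1 →
    Domination → AveragedCombStep → CertifiedAveragedStart Q →
    ∀ (hδ₀ : (0:ℝ) < 1 / 65536),
      ReleasedEnergyBound ⟨8, 1 / 65536, 2, 1, 2⟩ hδ₀ (by norm_num) 1000 (1 / 2)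
        ((1 - (Q + 400 * (3 / 40000) + 24 * (5 / 1000))) / 2 * FluidPDE.Torus.scalarL2Sq datum) 3

/-- The shape-P instance of the re-targeted crux (arbiter R1 of record). -/
def ShapePInstance : Prop :=
  ∃ δ₀ ∈ Set.Ioc (0:ℝ) (1 / 4), ∃ γ ∈ Set.Icc (5:ℝ) 8,
    CascadeFieldSmooth ⟨γ, δ₀, 2, 1, 2⟩ ∧ K1Localised ⟨γ, δ₀, 2, 1, 2⟩ (γ ^ 2 - 3)

/-- Plumbing check (how the line decides the crux): a `K1Localised` conclusion at `(8, 2⁻¹⁶, 2, 1, 2)` with rate `8² − 3` — which is what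
the seat's closer `K1Ledger.From.k1Localised_of_thin_iterate_bound` returns from `UniformThinBound … 3` (its `hiter`, with `a := iterate`,
`q < √E`) — is the shape-P instance, via `SawtoothCascade.cascadeFieldSmooth`. -/
example (h : K1Localised ⟨8, 1 / 65536, 2, 1, 2⟩ ((8:ℝ) ^ 2 - 3)) : ShapePInstance := by
  refine ⟨1 / 65536, ⟨by norm_num, by norm_num⟩, 8, ⟨by norm_num, le_rfl⟩, ?_, h⟩
  exact cascadeFieldSmooth _ (by norm_num) (by norm_num)


/-! ## 4. (rev 3, gen 2) Envelope-free averaged weight and the LANDED energy-ledger closer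

The closers landed since rev 2 (`K1Ledger.From.k1Localised_of_energy_ledger`, `…_of_weight_ledger_frequently`, p605765
`…LedgerThinChain`) track only the INDICATOR PAIR `[|k₀| < (1+1/250)c rⁿ] + [(1+1/250)c rⁿ ≤ |k₀| ∧ 13/10|k₀| < γ|k₁|]` — no Γ-envelope.
So the line's weight can drop the two envelope ramps: `w̄_n := 1 − b̄_low·b̄_cone` still dominates the pair pointwise (each ramp vanishes on
the corresponding indicator's support), is `≤ 1`, and is backward-invariant under every linear branch exactly as `μ̄` (K2 unchanged, minus the
envelope bookkeeping).  Numerically (lineage B, kit j299613/j299699) this removes the `env` column of `T̄` (0.014E at (8,2,½), 0.004E at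
(8,3,½)) and the whole `c = 7/20` envelope artefact of phases ≤ 2. -/

/-- Envelope-free threshold-averaged weight `w̄_n(k) = 1 − ramp((|k₀| − 1.004·c rⁿ)/(0.996·c rⁿ)) · ramp((1.3|k₀| − γ|k₁|)/(0.28|k₀|))`. -/
def barWeight (γ c : ℝ) (n : ℕ) (k : Fin 2 → ℤ) : ℝ :=
  1 - ramp ((|((k 0 : ℤ) : ℝ)| - (1 + 1 / 250) * c * (γ ^ 2 - 3) ^ n) / ((1 - 1 / 250) * c * (γ ^ 2 - 3) ^ n)) *
        ramp ((13 / 10 * |((k 0 : ℤ) : ℝ)| - γ * |((k 1 : ℤ) : ℝ)|) / ((13 / 10 - 51 / 50) * |((k 0 : ℤ) : ℝ)|))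

/-- Its tracked energy `W̄_n := Σ' w̄_n(k)‖𝓕a_n(k)‖²` on the explicit iterates. -/
def barWeightEnergy (P : CascadeParams) (hδ₀ : 0 < P.δ₀) (hd : 0 < P.d) (c : ℝ) (n : ℕ) : ℝ :=
  ∑' k : Fin 2 → ℤ, barWeight P.γ c n k * ‖mFourierCoeff (fun x => (iterate P hδ₀ hd n x : ℂ)) k‖ ^ 2

/-- **P1′ (support, elementary, replaces `Domination`):** the weight is bounded by `1`, and dominates the closer's indicator pair pointwise. -/
def WeightDominatesPair : Prop :=
  ∀ (γ c : ℝ) (n : ℕ) (k : Fin 2 → ℤ), 5 ≤ γ → 0 < c →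
    barWeight γ c n k ≤ 1 ∧
    (if |((k 0 : ℤ) : ℝ)| < (1 + 1 / 250) * (c * (γ ^ 2 - 3) ^ n) then (1 : ℝ) else 0) +
        (if (1 + 1 / 250) * (c * (γ ^ 2 - 3) ^ n) ≤ |((k 0 : ℤ) : ℝ)| ∧ 13 / 10 * |((k 0 : ℤ) : ℝ)| < γ * |((k 1 : ℤ) : ℝ)|
          then (1 : ℝ) else 0) ≤ barWeight γ c n k

/-- **K2′ (crux of the line, analytic; = `AveragedCombStep` for the envelope-free weight):** the per-phase increment `ℓ_j` of `W̄` from phase 3 on,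
at the instance `(γ, c) = (8, 1/2)`, uniformly in `δ₀ ≤ 1/256` — the `hstep`/`hℓ0`/`hℓs` inputs of `k1Localised_of_energy_ledger` with
`ℓ j = (C_s·2^j/((1/2)·61^j) + C_z·√(δ₀/2^j))·E`. -/
def AveragedWeightStep : Prop :=
  ∃ Cs Cz : ℝ, 0 ≤ Cs ∧ Cs ≤ 400 ∧ 0 ≤ Cz ∧ Cz ≤ 24 ∧
    ∀ (δ₀ : ℝ) (hδ₀ : 0 < δ₀), δ₀ ≤ 1 / 256 → ∀ j : ℕ, 3 ≤ j →
      barWeightEnergy ⟨8, δ₀, 2, 1, 2⟩ hδ₀ (by norm_num) (1 / 2) (j + 1) ≤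
        barWeightEnergy ⟨8, δ₀, 2, 1, 2⟩ hδ₀ (by norm_num) (1 / 2) j +
          (Cs * (2 ^ j / (1 / 2 * 61 ^ j)) + Cz * Real.sqrt (δ₀ / 2 ^ j)) * FluidPDE.Torus.scalarL2Sq datum

/-- **K3′ (the START at phase 3 — what the profile lens calibrates; see the card's «kernel path» paragraph for how it is meant to be DISCHARGED):**
`W̄_3 ≤ Q·E` at `(γ, δ₀, c) = (8, 2⁻¹⁶, 1/2)`.  Float value of record (two independent sparse exact-comb lineages, δ = 0, garbage counted as tracked):
`W̄_3/E ≈ T̄_3/E − env`: lineage B (record, kit j299699, garbage/E 0.0039) `0.0703 − 0.0041 = 0.066`; lineage A (kit j297862, garbage/E 0.0107)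
`0.0752 − 0.004 ≈ 0.071` — against the tolerance `Q < 1 − 0.15`. -/
def AveragedWeightStart (Q : ℝ) : Prop :=
  ∀ (hδ₀ : (0:ℝ) < 1 / 65536), barWeightEnergy ⟨8, 1 / 65536, 2, 1, 2⟩ hδ₀ (by norm_num) (1 / 2) 3 ≤ Q * FluidPDE.Torus.scalarL2Sq datum

/-- **Assembly′ (support, S): the line is an INSTANCE of the landed closer** `K1Ledger.From.k1Localised_of_energy_ledger` with
`a := iterate`, `T := barWeightEnergy … (1/2)`, `ℓ` from K2′, `i₁ = j₀ = 3`, `hdom` from `WeightDominatesPair` + `lowBand_add_highOffCone_le_weight`,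
`hbudget : Q·E + Σ'ℓ(3+i) < E` (geometric sums `Σ_{j≥3} 2^j/((1/2)61^j) ≤ 3/40000`, `Σ_{j≥3} √(2⁻¹⁶/2^j) ≤ 5/1000`). Output: the crux instance itself. -/
def LineAssemblyEnergy : Prop :=
  ∀ Q : ℝ, 0 ≤ Q → Q + 400 * (3 / 40000) + 24 * (5 / 1000) < 1 →
    WeightDominatesPair → AveragedWeightStep → AveragedWeightStart Q →
      K1Localised ⟨8, 1 / 65536, 2, 1, 2⟩ ((8:ℝ) ^ 2 - 3)

/-- Plumbing check for Assembly′: the closer's conclusion at the instance is literally the `K1Localised` conjunct of `ShapePInstance`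
(and `k1Localised_of_energy_ledger` is the landed theorem the support item instantiates — referenced here by name so the Sketch breaks if it moves). -/
example : LineAssemblyEnergy → WeightDominatesPair → AveragedWeightStep → AveragedWeightStart (3 / 4) → ShapePInstance := by
  intro hA hP hK2 hK3
  have h : K1Localised ⟨8, 1 / 65536, 2, 1, 2⟩ ((8:ℝ) ^ 2 - 3) := hA (3 / 4) (by norm_num) (by norm_num) hP hK2 hK3
  refine ⟨1 / 65536, ⟨by norm_num, by norm_num⟩, 8, ⟨by norm_num, le_rfl⟩, ?_, h⟩
  exact cascadeFieldSmooth _ (by norm_num) (by norm_num)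

/-- The two landed theorems the support item `LineAssemblyEnergy` instantiates (referenced by name: the Sketch stops elaborating if they move). -/
example := @Summit.AnomalousDissipation.AnomalousDissipation.Theorems.SawtoothPulseCascade.K1Ledger.From.k1Localised_of_energy_ledger
example := @Summit.AnomalousDissipation.AnomalousDissipation.Theorems.SawtoothPulseCascade.K1Ledger.From.lowBand_add_highOffCone_le_weight

end Summit.AnomalousDissipation.AnomalousDissipation.Cruxes.K1LocalisedCascade.AveragedCombLedger
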